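import Mathlib
import HarnessLib
import Literature.Analysis.FluidPDE.LocalTypeICongr

/-!
# Blow-up at a local Type I singular point (Albritton–Barker 2019, Thm. 1.1, forward direction;
# Seregin–Šverák 2009, Thm. 2.8), file 7:
# passing pointwise bounds to strong `L³` limits

Analysis/FluidPDE proof file (theorems only: no definition, no named fact, no `sorry`).  PORT NOTE: this
module is the Literature twin of the Summits-side file
`Summits/NavierStokesRegularity/NavierStokesRegularity/Theorems/HardyPointSinkABForwardHardyLimits.lean` (prover
seats of route HardyPointSink, landed 2026-08-16, kernel-checked), carried over verbatim up to the namespace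
(`Literature.Analysis.FluidPDE.LocalTypeIBlowup`, topic-aligned) and the provenance tags, so that the Literature named
facts `Literature.Analysis.FluidPDE.AlbrittonBarkerForward` (`LocalTypeICharacterization.lean`) and
`Literature.Analysis.FluidPDE.AlbrittonBarkerTypeICharacterization` (`LocalTypeI.lean`) are discharged INSIDE
`Literature/` (`AlbrittonBarkerForwardHolds.lean`), where `LocalTypeICharacterizationHolds.lean` asks for them; the
Summits copies are the dedup candidates of record (librarian pattern (b), promote request filed 2026-08-26).
The mathematics is the published blow-up procedure at a local Type I singular point (Seregin–Šverák 2009, §2 and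
Thm. 2.8; Albritton–Barker 2019, Prop. 2.4 and §3); nothing here is a claim about Navier–Stokes regularity.

Seventh helper file for the forward direction of Albritton–Barker 2019, Thm. 1.1.  Along a
sequence of fields converging strongly in `L³` on a parabolic ball a subsequence converges almost
everywhere (`exists_subseq_tendsto_ae`, private); hence uniform a.e. bounds `‖v_k‖ ≤ B` pass to
the limit (`ae_norm_le_of_tendsto_eLpNorm`; Seregin–Šverák 2009, proof of Thm. 2.8, (2.8):
"`sup |u| ≤ 1`" for the blow-up limit).  (The Summits twin also passes a route-specific weighted
`L²` bound to the limit by Fatou; that lemma is not carried over.)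

## References

* D. Albritton, T. Barker, J. Math. Fluid Mech. 21 (2019) = arXiv:1811.00502, Lemma 2.2, §3.
* G. Seregin, V. Šverák, Comm. PDE 34 (2009) = arXiv:0804.1803, §2 Thm. 2.8.
-/

noncomputable section

open MeasureTheory Set Function Filter Topology TopologicalSpace Metric
open scoped NNReal ENNReal
open Literature.Analysis Literature.Analysis.FluidPDE

namespace Literature.Analysis.FluidPDE.LocalTypeIBlowup


/-- **Strong `L³` convergence has an a.e. convergent subsequence.** [folklore] -/
private theorem exists_subseq_tendsto_ae {Q₀ : Set (ℝ × (EuclideanSpace ℝ (Fin 3)))} {v : ℕ → ℝ → (EuclideanSpace ℝ (Fin 3)) → (EuclideanSpace ℝ (Fin 3))} {U : ℝ → (EuclideanSpace ℝ (Fin 3)) → (EuclideanSpace ℝ (Fin 3))}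
    (hv : ∀ k, AEStronglyMeasurable (uncurry (v k)) (volume.restrict Q₀))
    (hU : AEStronglyMeasurable (uncurry U) (volume.restrict Q₀))
    (hconv : Tendsto (fun k => eLpNorm (uncurry (v k) - uncurry U) 3 (volume.restrict Q₀))
      atTop (𝓝 0)) :
    ∃ φ : ℕ → ℕ, StrictMono φ ∧ ∀ᵐ w ∂(volume.restrict Q₀),
      Tendsto (fun i => uncurry (v (φ i)) w) atTop (𝓝 (uncurry U w)) :=
  (tendstoInMeasure_of_tendsto_eLpNorm (by norm_num) hv hU hconv).exists_seq_tendsto_ae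

/-- **Uniform a.e. bounds pass to strong `L³` limits** (Seregin–Šverák 2009, (p8)). [cite: SereginSverak2009, §2 proof of Thm 2.8 (the strong limit of the rescaled solutions bounded by 1 inherits the bound)] -/
theorem ae_norm_le_of_tendsto_eLpNorm {Q₀ : Set (ℝ × (EuclideanSpace ℝ (Fin 3)))} {v : ℕ → ℝ → (EuclideanSpace ℝ (Fin 3)) → (EuclideanSpace ℝ (Fin 3))}
    {U : ℝ → (EuclideanSpace ℝ (Fin 3)) → (EuclideanSpace ℝ (Fin 3))} {B : ℝ}
    (hv : ∀ k, AEStronglyMeasurable (uncurry (v k)) (volume.restrict Q₀))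
    (hU : AEStronglyMeasurable (uncurry U) (volume.restrict Q₀))
    (hconv : Tendsto (fun k => eLpNorm (uncurry (v k) - uncurry U) 3 (volume.restrict Q₀))
      atTop (𝓝 0))
    (hbd : ∀ k, ∀ᵐ w ∂(volume.restrict Q₀), ‖uncurry (v k) w‖ ≤ B) :
    ∀ᵐ w ∂(volume.restrict Q₀), ‖uncurry U w‖ ≤ B := by
  obtain ⟨φ, -, hae⟩ := exists_subseq_tendsto_ae hv hU hconv
  have hall : ∀ᵐ w ∂(volume.restrict Q₀), ∀ k, ‖uncurry (v k) w‖ ≤ B := ae_all_iff.2 hbd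
  filter_upwards [hae, hall] with w hw hw'
  exact le_of_tendsto hw.norm (Eventually.of_forall fun i => hw' (φ i))

/-- `Q(0, R)` as the product `(-R², 0) × B(0, R)` at the level of restricted measures. [folklore] -/
private theorem volume_restrict_parabolicCylinder_zero (R : ℝ) :
    (volume.restrict (parabolicCylinder R (0 : ℝ × (EuclideanSpace ℝ (Fin 3)))) : Measure (ℝ × (EuclideanSpace ℝ (Fin 3)))) =
      (volume.restrict (Ioo (-R ^ 2) 0)).prod (volume.restrict (ball (0 : (EuclideanSpace ℝ (Fin 3))) R)) := by
  have h := volume_restrict_parabolicCylinder_eq_prod' R (0 : ℝ × (EuclideanSpace ℝ (Fin 3)))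
  rw [Prod.fst_zero, Prod.snd_zero, zero_sub] at h
  exact h


end Literature.Analysis.FluidPDE.LocalTypeIBlowup

end
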